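import Mathlib

/-!
# Stub P3 `stub_liaSymbol` (line `child_tangent_analytic_strip`, child 28295 of `SkeletonJ1G`) — CERTIFIED NUMERICS, DEFINITIONS
# (rational enclosures of `e^{−y}`, bracket sums for `C(p) = ∫₀^∞ e^{−t}e^{−p/t} dt`, `E(p) = ∫₀^∞ e^{−t}e^{−p/t} dt/t`, grids, checker)

Lane ns-filament-19175-p1 g12 (prover), 2026-08-28, `--supports stmt-NavierStokesRegularity-28295 --as helper`.  Statement-only
file (definitions; no theorem): the soundness proofs are `…LiaSymbolNumericsSound`, the kernel-replayed certificate and the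
numerical window `Φ(p) = 1 − C(p) − 2pE(p) ∈ [−1/12, p/3]` on `p ∈ [1/50, 3]` are `…LiaSymbolNumericsCert`.

* `rdn`/`rup`: rounding to the dyadic grid `2^{-62}` (keeps the rationals small);
* `expNegLo y ≤ e^{−y} ≤ expNegHi y` (`y ≥ 0`): Taylor polynomial of degree 8 with Mathlib's remainder at `y/2^7 ∈ [0, ½]`,
  then 7 rounded squarings; arguments beyond `64` are capped (`0` below, `e^{−64}`-bound above);
* `Cint`, `Eint`, `Phi`: the real integrals; `lowerC/lowerE/upperC/upperE/Cup/Eup`: monotone bracket sums over a grid of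
  triples `(t, expNegLo t, expNegHi t)` (the integrands are products of the monotone factors `e^{−t}`, `e^{−p/t}`, `1/t`),
  the upper ones with the explicit tails `∫₀^{t₀} ≤ t₀e^{−p/t₀}` (resp. `(2t₀/p)e^{−p/(2t₀)}`) and `∫_{t_L}^∞ ≤ e^{−t_L}` (resp. `/t_L`);
* `gridOK`, `Encl`, `tgrid` (1190 nodes, `3·10⁻⁴ … ≈ 41`, ratio `≈ 1.01`), `tdata`, `cellOK`/`cellsOK` (the `p`-cell checks:
  since `C`, `E` are antitone, on `[a,b]` `Φ ≤ 1 − C(b) − 2aE(b)` and `Φ ≥ 1 − C(a) − 2bE(a)`), `pgridTail` (440 cells on `[1/50,3]`).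

HONEST FRAMING: certified numerics for one explicit real integral, serving a HYPOTHETICAL filament-skeleton line on the
NEGATIVE side of a MODEL route; nothing here bears on Navier–Stokes regularity or blow-up.
-/

set_option linter.dupNamespace false

noncomputable section

namespace Summit.NavierStokesRegularity.NavierStokesRegularity.Theorems.AnalyticStripLiaSymbol

open Real Set MeasureTheory Filter Topology

namespace Numerics

/-- Working precision: denominators `2^62`. -/
def prec : ℕ := 62

/-- Round a rational DOWN to the dyadic grid. -/
def rdn (q : ℚ) : ℚ := (Int.floor (q * 2 ^ prec) : ℚ) / 2 ^ prec

/-- Round a rational UP to the dyadic grid. -/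
def rup (q : ℚ) : ℚ := (Int.ceil (q * 2 ^ prec) : ℚ) / 2 ^ prec

/-- Taylor terms. -/
def NT : ℕ := 9

/-- Squarings (`2^7 = 128`; arguments are reduced to `[0, ½]`). -/
def KS : ℕ := 7

/-- Taylor polynomial of `e^{−s}` of degree `NT − 1`. -/
def taylor (s : ℚ) : ℚ := ∑ m ∈ Finset.range NT, (-s) ^ m / (m.factorial : ℚ)

/-- Mathlib's remainder bound `s^NT (NT+1)/(NT!·NT)`. -/
def terr (s : ℚ) : ℚ := s ^ NT * (((NT : ℚ) + 1) / ((NT.factorial : ℚ) * NT))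

/-- `k` certified squarings, rounding down. -/
def sqLo : ℕ → ℚ → ℚ
  | 0, q => q
  | k + 1, q => sqLo k (rdn (q * q))

/-- `k` certified squarings, rounding up. -/
def sqHi : ℕ → ℚ → ℚ
  | 0, q => q
  | k + 1, q => sqHi k (rup (q * q))

/-- Lower bound of `e^{−y}` for rational `y ≥ 0` (`0` beyond `y = 64`). -/
def expNegLo (y : ℚ) : ℚ :=
  if 64 < y then 0 else sqLo KS (max 0 (rdn (taylor (y / 2 ^ KS) - terr (y / 2 ^ KS))))

/-- Upper bound of `e^{−y}` on `[0, 64]`. -/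
def expNegHiCore (y : ℚ) : ℚ := sqHi KS (rup (taylor (y / 2 ^ KS) + terr (y / 2 ^ KS)))

/-- Upper bound of `e^{−y}` for rational `y ≥ 0` (argument capped at `64`). -/
def expNegHi (y : ℚ) : ℚ := expNegHiCore (min y 64)

/-- `C(p) = ∫₀^∞ e^{−t} e^{−p/t} dt` (`= 2√p·K₁(2√p)`). -/
def Cint (p : ℝ) : ℝ := ∫ t in Ioi (0:ℝ), Real.exp (-t) * Real.exp (-(p / t))

/-- `E(p) = ∫₀^∞ e^{−t} e^{−p/t} dt/t` (`= 2K₀(2√p)`). -/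
def Eint (p : ℝ) : ℝ := ∫ t in Ioi (0:ℝ), Real.exp (-t) * Real.exp (-(p / t)) / t

/-- `Φ(p) = 1 − C(p) − 2pE(p)` (`= 𝔖(2√p)`). -/
def Phi (p : ℝ) : ℝ := 1 - Cint p - 2 * p * Eint p

/-- Lower bracket sum for `C` (tails dropped). -/
def lowerC (p : ℚ) : List (ℚ × ℚ × ℚ) → ℚ
  | x :: y :: rest => rdn ((y.1 - x.1) * y.2.1 * expNegLo (p / x.1)) + lowerC p (y :: rest)
  | _ => 0

/-- Lower bracket sum for `E` (tails dropped). -/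
def lowerE (p : ℚ) : List (ℚ × ℚ × ℚ) → ℚ
  | x :: y :: rest => rdn ((y.1 - x.1) * y.2.1 * expNegLo (p / x.1) / y.1) + lowerE p (y :: rest)
  | _ => 0

/-- Upper bracket sum for `C`, including the tail `∫_{t_last}^∞ ≤ e^{−t_last}`. -/
def upperC (p : ℚ) : List (ℚ × ℚ × ℚ) → ℚ
  | [] => 0
  | [x] => expNegHi x.1
  | x :: y :: rest => rup ((y.1 - x.1) * x.2.2 * expNegHi (p / y.1)) + upperC p (y :: rest)

/-- Upper bracket sum for `E`, including the tail `∫_{t_last}^∞ ≤ e^{−t_last}/t_last`. -/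
def upperE (p : ℚ) : List (ℚ × ℚ × ℚ) → ℚ
  | [] => 0
  | [x] => rup (expNegHi x.1 / x.1)
  | x :: y :: rest => rup ((y.1 - x.1) * x.2.2 * expNegHi (p / y.1) / x.1) + upperE p (y :: rest)

/-- Full upper bound for `C`: head tail `∫₀^{t₀} ≤ t₀ e^{−p/t₀}` + sum. -/
def Cup (p : ℚ) : List (ℚ × ℚ × ℚ) → ℚ
  | [] => 0
  | x :: rest => rup (x.1 * expNegHi (p / x.1)) + upperC p (x :: rest)

/-- Full upper bound for `E`: head tail `∫₀^{t₀} ≤ (2t₀/p) e^{−p/(2t₀)}` + sum. -/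
def Eup (p : ℚ) : List (ℚ × ℚ × ℚ) → ℚ
  | [] => 0
  | x :: rest => rup (2 * x.1 / p * expNegHi (p / (2 * x.1))) + upperE p (x :: rest)

/-- Well-formed grid: positive, strictly increasing nodes. -/
def gridOK : List (ℚ × ℚ × ℚ) → Bool
  | [] => true
  | [x] => decide (0 < x.1)
  | x :: y :: rest => decide (0 < x.1) && decide (x.1 < y.1) && gridOK (y :: rest)

/-- The enclosure property of a grid of triples. -/
def Encl (l : List (ℚ × ℚ × ℚ)) : Prop :=
  ∀ x ∈ l, ((x.2.1 : ℚ) : ℝ) ≤ Real.exp (-(x.1:ℝ)) ∧ Real.exp (-(x.1:ℝ)) ≤ ((x.2.2 : ℚ) : ℝ)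

/-- Geometric-ish `t`-grid: `t₀ = 3·10⁻⁴`, ratio `≈ 1.01`, `n` nodes (dyadic-rounded). -/
def tgridAux : ℕ → ℚ → List ℚ
  | 0, _ => []
  | n + 1, t => t :: tgridAux n (rup (t * (101 / 100)))

/-- The `t`-grid (1190 nodes, `3·10⁻⁴ … ≈ 41`). -/
def tgrid : List ℚ := tgridAux 1190 (3 / 10000)

/-- The grid of triples `(t, expNegLo t, expNegHi t)`. -/
def tdata : List (ℚ × ℚ × ℚ) := tgrid.map fun t => (t, expNegLo t, expNegHi t)

/-- All nodes nonnegative (checked). -/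
def nonnegAll (l : List ℚ) : Bool := l.all fun t => decide (0 ≤ t)

/-- One `p`-cell `[a, b]`: (a) `Φ ≤ p/3` via `1 − lowerC(b) − 2a·lowerE(b) ≤ a/3`; (b) `Φ ≥ −1/12` via
`−1/12 ≤ 1 − Cup(a) − 2b·Eup(a)`. -/
def cellOK (l : List (ℚ × ℚ × ℚ)) (a b : ℚ) : Bool :=
  decide (0 < a) && decide (a ≤ b) &&
    decide (1 - lowerC b l - 2 * a * lowerE b l ≤ a / 3) &&
    decide (-1 / 12 ≤ 1 - Cup a l - 2 * b * Eup a l)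

/-- Check all consecutive cells of a `p`-grid. -/
def cellsOK (l : List (ℚ × ℚ × ℚ)) : List ℚ → Bool
  | a :: b :: rest => cellOK l a b && cellsOK l (b :: rest)
  | _ => true

/-- Last node of `a :: rest`. -/
def lastQ : ℚ → List ℚ → ℚ
  | a, [] => a
  | _, b :: rest => lastQ b rest

/-- The `p`-grid tail after the head `1/50`: steps `10⁻³` on `[0.02, 0.2]`, `5·10⁻³` on `[0.2, 1]`, `2·10⁻²` on `[1, 3]`. -/
def pgridTail : List ℚ :=
  ((List.range 180).map fun j => ((21 : ℚ) + j) / 1000) ++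
  ((List.range 160).map fun j => ((205 : ℚ) + 5 * j) / 1000) ++
  ((List.range 100).map fun j => ((102 : ℚ) + 2 * j) / 100)

end Numerics

end Summit.NavierStokesRegularity.NavierStokesRegularity.Theorems.AnalyticStripLiaSymbol
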